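import Literature.RepresentationTheory.KashiwaraVergne1978.HarmonicParameters

/-!
# Kashiwara–Vergne (1978), Ch. III, Theorems (6.3) and (7.2) as typed statements about the
# decomposition `L_k|_{U(p,q)} = ⊕_{λ ∈ Σ} (dim V_λ) L_k(λ)` — dictionary level

Companion of `Literature.RepresentationTheory.KashiwaraVergne1978.HarmonicParameters` (the REAL
combinatorics of `Σ`, `τ(λ)`, `τ(λ) ⊗ δ_k`): here the two theorems are typed AS STATEMENTS ABOUT
REPRESENTATIONS, on an explicit DICTIONARY `KVHarmonicUpq k p q` (the set `Σ ⊂ U(k)^`, the relation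
`τ(λ) ≅ τ`, irreducible unitary representations of `G = U(p,q)` up to equivalence, `λ ↦ L_k(λ)`,
"`π` has highest weight `τ`", multiplicities in `L_k`, `dim V_λ`, "`ℒ_{k,λ} ≅ π ⊗ V_λ`").  NOTHING IS
ASSERTED (the tree has no oscillator representation); consumers take `(h : D.Thm_6_3)`,
`(h : D.Thm_7_2)` as hypotheses.  Source: M. Kashiwara, M. Vergne, Invent. Math. **44** (1978)
1–47, Ch. III [KashiwaraVergne1978], read on the GDZ page images; quotations verbatim.

Standing set-up of Ch. III (verbatim): (1.1) p. 31 "We consider the complex vector space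
`ℂ^q ⊕ ℂ^r ⊕ ℂ^q` … (`p = q + r`)" [so `q ≤ p`]; p. 32 "`G = U(p, q) = {g; g*hg = h}`"; (1.4) p. 32 "the
unique class of unitary irreducible representation `T` of `H` such that `T(0, t) = e^{it} Id`";
(1.5) p. 33 "Let us consider any non negative integer `k` and `L_k` the `k`-th tensor product of the
representation `L`"; §2 p. 34 "On `ℒ_k` the action of the unitary group `U(k)` given by
`(h·f)(x) = f(xh)` commutes with the representation `L_k`; … `ℒ_k = ⊕_{λ∈U(k)^} ℒ_{k,λ}`"; (2.1) p. 34
"We denote by `L_k(λ)` the corresponding representation. Let `λ′` be the contragredient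
representation of `λ` … Then `ℒ_{k,λ} = ℒ(λ′) ⊗ V_λ` … Therefore we have
`ℒ_k = ⊕_{λ∈U(k)^} L_k(λ′) ⊗ V_λ` as a representation on space of `G × U(k)`"; (4.1) p. 39 "Here
`δ_k(g₁, g₂) = (det g₂)^k`"; (5.5) p. 42 "We shall denote by `Σ` the subset of `λ ∈ U(k)^` such that
`ℌ(λ) ≠ 0`. … For `λ ∈ Σ` we denote by `τ(λ)` the representation of `GL(p, ℂ) × GL(q, ℂ)` on `ℌ(λ)`";
(5.6) "Proposition. `τ = τ(λ)` is an irreducible representation of `GL(p, ℂ) × GL(q, ℂ)`."; §6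
pp. 43–44: highest weights w.r.t. the UPPER triangular `𝔟_k`, `𝔟_p⁺ × 𝔟_q⁺`.
**Theorem (6.3)** p. 44: "a) `Σ = {λ = (n₁, …, n_i, 0, …, 0, −m₁, −m₂, …, −m_j)  n₁ ≥ ⋯ ≥ n_i > 0,
0 < m₁ ≤ m₂ ≤ ⋯ ≤ m_j, 0 ≤ i ≤ q, 0 ≤ j ≤ p, i + j ≤ k`. b) If `λ ∈ Σ`, the representation `τ(λ)` is
`τ₁(0, 0, …, 0, −m₁, −m₂, …, −m_j) ⊗ τ₂(n₁, …, n_i, 0, …, 0)`. c) For any `k`, the map `λ ↦ τ(λ)` is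
injective."  **(7.1)–(7.2)** pp. 44–45: "we see that `L_k(λ)` is an irreducible unitary
representation of `G` of highest weight `τ(λ) ⊗ δ_k`. On the other hand we have
`ℒ_k = ⊕_{λ∈Σ} ℒ_k(λ) ⊗ V_λ`, and hence `ℒ_k = ⊕_{λ∈Σ} (dim V_λ) ℒ_k(λ)`. Since `λ ↦ τ(λ)` is injective
(6.3) we have (7.2) Theorem. 1) For `λ ∈ Σ`, the representation `L_k(λ)` appears in `L_k`
`dim V_λ`-times, and we have `L_k = ⊕_{λ∈Σ} (dim V_λ) L_k(λ)`. 2) For `λ ∈ Σ`, the representation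
`L_k(λ)` is an irreducible unitary representation of `G` of highest weight `τ(λ) ⊗ δ_k`. 3) The
description of `Σ` and `τ(λ)` is given in (6.3)."

Proved here: `sigma_lam`, `existsUnique_param` (Howe duality for `(U(k), U(p,q))` in KV's form),
`lam_eq_of_lowest_eq`, `isotypic_one_two_one` (the line `(k; p, q) = (1; 2, 1)`).

NOT here: `ℒ_k`, `ℌ`, `T(τ)`, (8.1)–(8.6) (which `L_k(λ)` are discrete series).

## References
* M. Kashiwara, M. Vergne, Invent. Math. 44 (1978), III (1.1)–(1.5), (2.1), (4.1), (5.5)–(5.6), §6,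
  Thm (6.3), (7.1)–(7.2), (8.1). [KashiwaraVergne1978]
-/

namespace Literature.RepresentationTheory.KashiwaraVergne1978

universe u

/-- Dictionary for KV78 Ch. III (integer highest weights as in §6): `Sigma λ` — `λ ∈ Σ` ((5.5));
`tau λ τ` — `τ(λ) ≅ τ = τ₁ ⊗ τ₂` ((5.5), §6); `Rep` — irreducible unitary representations of
`G = U(p,q)` up to equivalence; `L λ` — `L_k(λ)` ((2.1)); `highestWeight π τ` — "`π` is an irreducible
unitary representation of `G` of highest weight `τ`" ((7.1), (8.1)); `mult π` — the multiplicity of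
`π` in `L_k`; `dimV λ` — `dim V_λ`; `isotypic λ π` — "`ℒ_{k,λ} ≅ π ⊗ V_λ` as a representation of
`G × U(k)`". [cite: KashiwaraVergne1978, III (2.1) p. 34, (5.5) p. 42, (7.1)–(7.2) pp. 44–45] -/
structure KVHarmonicUpq (k p q : ℕ) where
  /-- `λ ∈ Σ` ((5.5)) -/
  Sigma : (Fin k → ℤ) → Prop
  /-- `τ(λ) ≅ τ₁ ⊗ τ₂` with the displayed `𝔟_p⁺ × 𝔟_q⁺` highest weights ((5.5), §6) -/
  tau : (Fin k → ℤ) → (Fin p → ℤ) × (Fin q → ℤ) → Prop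
  /-- irreducible unitary representations of `G = U(p,q)` up to equivalence -/
  Rep : Type u
  /-- `L_k(λ)` ((2.1)) -/
  L : (Fin k → ℤ) → Rep
  /-- "irreducible unitary representation of `G` of highest weight `τ`" ((7.1), (8.1)) -/
  highestWeight : Rep → (Fin p → ℤ) × (Fin q → ℤ) → Prop
  /-- multiplicity of `π` in `L_k` -/
  mult : Rep → ℕ
  /-- `dim V_λ` -/
  dimV : (Fin k → ℤ) → ℕ
  /-- `ℒ_{k,λ} ≅ π ⊗ V_λ` as a `G × U(k)`-representation ((2.1)) -/
  isotypic : (Fin k → ℤ) → Rep → Prop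

namespace KVHarmonicUpq

variable {k p q : ℕ}

/-- **KV III Theorem (6.3)**, transcribed: (a) `Σ` is exactly the set of `KVParam.lam` (stated for
all `λ : Fin k → ℤ`; for a non-dominant `λ` both sides are false); (b) `τ(λ(P)) = P.tau`, `τ(λ)`
single-valued; (c) on `Σ`, `τ(λ) = τ(λ')` forces `λ = λ'` (for the explicit data (c) is moreover
KERNEL: `KVParam.lam_eq_of_tau_eq`).
[cite: KashiwaraVergne1978, III Thm (6.3) p. 44, with (5.5)–(5.6) p. 42, §6 pp. 43–44] -/
def Thm_6_3 (D : KVHarmonicUpq.{u} k p q) : Prop :=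
  (∀ lam : Fin k → ℤ, D.Sigma lam ↔ ∃ P : KVParam k p q, lam = P.lam) ∧
  (∀ P : KVParam k p q, D.tau P.lam P.tau) ∧
  (∀ (lam : Fin k → ℤ) (τ τ' : (Fin p → ℤ) × (Fin q → ℤ)), D.tau lam τ → D.tau lam τ' → τ = τ') ∧
  (∀ (lam lam' : Fin k → ℤ) (τ : (Fin p → ℤ) × (Fin q → ℤ)),
    D.Sigma lam → D.Sigma lam' → D.tau lam τ → D.tau lam' τ → lam = lam')

/-- **KV III Theorem (7.2)** (with (7.1), (2.1), (4.1)), transcribed: (2) for `λ = λ(P) ∈ Σ`,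
`L_k(λ)` has highest weight `P.lowest = τ(λ) ⊗ δ_k`, and a representation has at most one highest
weight; (1) `mult (L_k(λ)) = dim V_λ` (`λ ∈ Σ`), every `π` with `mult π ≠ 0` is some `L_k(λ)`, and
`λ ↦ L_k(λ)` is injective on `Σ` ("Since `λ ↦ τ(λ)` is injective"); (2.1) the `λ`-isotypic part of
`ℒ_k` under `U(k)` is `L_k(λ′) ⊗ V_λ` whenever `λ′ ∈ Σ`.
[cite: KashiwaraVergne1978, III (7.1)–(7.2) pp. 44–45, (2.1) p. 34, (4.1) p. 39] -/
def Thm_7_2 (D : KVHarmonicUpq.{u} k p q) : Prop :=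
  (∀ P : KVParam k p q, D.highestWeight (D.L P.lam) P.lowest) ∧
  (∀ (π : D.Rep) (τ τ' : (Fin p → ℤ) × (Fin q → ℤ)),
    D.highestWeight π τ → D.highestWeight π τ' → τ = τ') ∧
  (∀ lam : Fin k → ℤ, D.Sigma lam → D.mult (D.L lam) = D.dimV lam) ∧
  (∀ π : D.Rep, D.mult π ≠ 0 → ∃ lam : Fin k → ℤ, D.Sigma lam ∧ π = D.L lam) ∧
  (∀ lam lam' : Fin k → ℤ, D.Sigma lam → D.Sigma lam' → D.L lam = D.L lam' → lam = lam') ∧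
  (∀ lam : Fin k → ℤ, D.Sigma (kvDual lam) → D.isotypic lam (D.L (kvDual lam)))

variable (D : KVHarmonicUpq.{u} k p q)

/-- Every `λ(P)` lies in `Σ`. [cite: KashiwaraVergne1978, III Thm (6.3) a) p. 44] -/
theorem sigma_lam (h63 : D.Thm_6_3) (P : KVParam k p q) : D.Sigma P.lam :=
  (h63.1 P.lam).mpr ⟨P, rfl⟩

/-- Howe duality for `(U(k), U(p,q))` in KV's form: every irreducible `π` of `U(p,q)` occurring in
`L_k` is `L_k(λ)` for exactly one `λ ∈ Σ`. [cite: KashiwaraVergne1978, III Thm (7.2) p. 45] -/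
theorem existsUnique_param (h72 : D.Thm_7_2) {π : D.Rep} (hπ : D.mult π ≠ 0) :
    ∃! lam : Fin k → ℤ, D.Sigma lam ∧ π = D.L lam := by
  obtain ⟨-, -, -, h4, h5, -⟩ := h72
  obtain ⟨lam, hS, rfl⟩ := h4 π hπ
  exact ⟨lam, ⟨hS, rfl⟩, fun lam' ⟨hS', e⟩ => (h5 lam lam' hS hS' e).symm⟩

/-- Two parameters with the same `τ(λ) ⊗ δ_k` (the same highest weight of `L_k(λ)`) give the same
`λ` — from (6.3 b), (6.3 c) and `δ_k`-cancellation.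
[cite: KashiwaraVergne1978, III Thm (6.3) b), c) p. 44, (4.1) p. 39] -/
theorem lam_eq_of_lowest_eq (h63 : D.Thm_6_3) {P P' : KVParam k p q}
    (e : P.lowest = P'.lowest) : P.lam = P'.lam := by
  have hS : D.Sigma P.lam := D.sigma_lam h63 P
  have hS' : D.Sigma P'.lam := D.sigma_lam h63 P'
  obtain ⟨-, hb, -, hc⟩ := h63
  have ht : P.tau = P'.tau := KVParam.tau_eq_of_lowest_eq e
  exact hc P.lam P'.lam P.tau hS hS' (hb P) (ht ▸ hb P')

/-- Distinct parameters in `Σ` give inequivalent `L_k(λ)`.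
[cite: KashiwaraVergne1978, III Thm (7.2) 1) p. 45] -/
theorem L_injective_on_params (h63 : D.Thm_6_3) (h72 : D.Thm_7_2) {P P' : KVParam k p q}
    (e : D.L P.lam = D.L P'.lam) : P.lam = P'.lam :=
  h72.2.2.2.2.1 P.lam P'.lam (D.sigma_lam h63 P) (D.sigma_lam h63 P') e

/-- `(k; p, q) = (1; 2, 1)`: for every `s ∈ ℤ`, `(−s) ∈ Σ`, the `(s)`-isotypic part of `ℒ₁` under
`U(1)` is `L₁((−s)) ⊗ V_{(s)}`, and `L₁((−s))` is irreducible unitary of highest weight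
`(0, min(−s,0)) ⊗ (max(−s,0) + 1)` (`KVParam.exists_one_two_one`).
[cite: KashiwaraVergne1978, III Thm (6.3) p. 44, Thm (7.2) p. 45, (2.1) p. 34] -/
theorem isotypic_one_two_one (D : KVHarmonicUpq.{u} 1 2 1) (h63 : D.Thm_6_3) (h72 : D.Thm_7_2)
    (s : ℤ) :
    D.Sigma (fun _ => -s) ∧ D.isotypic (fun _ => s) (D.L fun _ => -s) ∧
      D.highestWeight (D.L fun _ => -s) (![0, min (-s) 0], ![max (-s) 0 + 1]) := by
  obtain ⟨P, hP, hlow⟩ := KVParam.exists_one_two_one (-s)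
  have hSig : D.Sigma (fun _ => -s) := (h63.1 _).mpr ⟨P, hP.symm⟩
  have hdual : kvDual (fun _ : Fin 1 => s) = fun _ => -s := by
    funext ν
    simp [kvDual]
  refine ⟨hSig, ?_, ?_⟩
  · have h6 := h72.2.2.2.2.2 (fun _ => s)
    rw [hdual] at h6
    exact h6 hSig
  · have h1 := h72.1 P
    rw [hP, hlow] at h1
    exact h1

end KVHarmonicUpq

end Literature.RepresentationTheory.KashiwaraVergne1978
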